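import Summits.HodgeConjecture.HodgeConjecture.Theorems.CyclicUnitaryPowersAffineCoordExtension
import Summits.HodgeConjecture.HodgeConjecture.Theorems.CyclicUnitaryPowersTopFormRatioGrowth
import Literature.Analysis.Complex.AffineHypersurfaceSerreLemma
import Literature.Geometry.Kaehler.SurfaceHolomorphicTwoFormRatio
import Literature.AlgebraicGeometry.HodgeTheory.HypersurfaceResidueFormSymmetry

/-!
# Holomorphic top forms on a smooth hypersurface are Griffiths residues — on one affine chart

Prover seat `hodge-nonav-prover-Bx` (g11), cell `hodge-nonav`, programme PG-GENERAL (discharge of the geometric-genus binder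
PG = `Arapura2012_hypersurface_geometricGenus` of the cruxes K1-A/K1-B, stmt-HodgeConjecture-19544 ∕ 19716). Setting of the
tree's residue forms (`HypersurfaceResidueFormDef`): `F` homogeneous of degree `d ≥ m + 2` in `m + 2` variables with
non-vanishing gradient on its cone, `M` a COMPACT complex manifold charted on `E` (`dim_ℂ E = m`), `ψ : M → ℙ(ℂ^{m+2})` a
topological embedding ONTO `V(F)` with holomorphic affine coordinates, `k = d - (m + 2)`.

* `residueForm_eq_eval_smul` — on the chart `M_{i₀} = {x_{i₀} ≠ 0}`, `Res(QΩ/F) = Q(Z̃_{i₀}) • Res(x_{i₀}^k Ω/F)` for `Q`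
  homogeneous of degree `k` (the frame `η_{i₀} = Res(x_{i₀}^k Ω/F)` is nowhere zero there, `residueForm_ne_zero`).
* `exists_eq_residueForm_on_liftDomain` — **every holomorphic `m`-form `η` on `M` is a residue on `M_{i₀}`**:
  `η = ψ^* Res(QΩ/F)` on `M_{i₀}` for some `Q` homogeneous of degree `k`, PROVIDED the affine equation
  `h = F(x_{i₀} = 1)` is in Noether normal form along the coordinate `t = x₀/x_{i₀}` (leading coefficient of `t^d` a
  non-zero constant) with a separable fibre at infinity. Proof: `η = f · η_{i₀}` on `M_{i₀}` with `f` holomorphic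
  (`mdifferentiableAt_topFormRatio_of_isHolomorphicInCharts`), of growth `(1 + |u|)^k` in the affine coordinates (brick F1c
  `exists_bound_topFormRatio`) and locally the restriction of holomorphic functions of `ℂ^{m+1}` (brick F1b
  `exists_differentiableOn_eqOn_image_affineCoord`); by SERRE'S ALGEBRAISATION LEMMA on the smooth affine hypersurface
  `{h = 0}` (`Literature.Analysis.Complex.AffineHypersurface.exists_mvPolynomial_eq_on_hypersurface`) `f = q(u)` with
  `deg q ≤ k`; homogenising, `η = Q(Z̃_{i₀}) · η_{i₀} = Res(QΩ/F)`.

Sorry-free; no definition, no named fact; helper (`--supports stmt-HodgeConjecture-19716`); nothing here says HC ∕ HC_AV is proved.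
(Griffiths 1969 §8 ∕ Voisin II Cor. 6.12 at `p = 1`: `H^{m,0}(X_F) ≅ S^{d-m-2}`, here the surjectivity half, analytically.)
-/

noncomputable section

set_option linter.dupNamespace false

open scoped Manifold ContDiff Topology LinearAlgebra.Projectivization
open Set Filter Function Projectivization Polynomial

namespace Summit.HodgeConjecture.HodgeConjecture.Theorems.SmoothHypersurfaceTopFormsOnChart

open Literature.AlgebraicGeometry.HodgeTheory Literature.NumberTheory.Transcendental Literature.Geometry.Kaehler
  Literature.Analysis.Complex Literature.Analysis.Complex.AffineHypersurface
  Summit.HodgeConjecture.HodgeConjecture.Theorems.CyclicUnitaryPowersAffineCoordExtension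
  Summit.HodgeConjecture.HodgeConjecture.Theorems.CyclicUnitaryPowersTopFormRatioGrowth

variable {m : ℕ} {E : Type*} [NormedAddCommGroup E] [NormedSpace ℂ E] [FiniteDimensional ℂ E]
  {M : Type*} [TopologicalSpace M] [ChartedSpace E M] [IsManifold 𝓘(ℂ, E) ω M] [IsManifold 𝓘(ℝ, E) ∞ M]
  (ψ : M → ℙ ℂ (Fin (m + 2) → ℂ)) {F : MvPolynomial (Fin (m + 2)) ℂ} {d : ℕ}

/-! ### Change of numerator on a chart -/

omit [FiniteDimensional ℂ E] [IsManifold 𝓘(ℂ, E) ω M] [IsManifold 𝓘(ℝ, E) ∞ M] in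
/-- **Change of numerator on the chart `M_{i₀}`**: for `Q` homogeneous of degree `k`,
`ψ^* Res(QΩ/F) = Q(Z̃_{i₀} x) • ψ^* Res(x_{i₀}^k Ω/F)` at every `x ∈ M_{i₀}` (both sides are `P(Z̃_i x) · coneResidue`
for the pointwise lift `Z̃_i`, and `Q(Z̃_i) / (Z̃_i)_{i₀}^k = Q(Z̃_{i₀})` by homogeneity). [cite: VoisinHodgeII2003, §6.1.3] -/
theorem residueForm_eq_eval_smul {k : ℕ} {Q : MvPolynomial (Fin (m + 2)) ℂ} (hQ : Q.IsHomogeneous k)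
    {i₀ : Fin (m + 2)} {x : M} (hx : x ∈ liftDomain ψ i₀) :
    residueForm (E := E) ψ F Q x =
      MvPolynomial.eval (projLift ψ i₀ x) Q • residueForm (E := E) ψ F (MvPolynomial.X i₀ ^ k) x := by
  have hix : x ∈ liftDomain ψ (residueIdx ψ x) := residueIdx_spec ψ x
  have hzi₀ : projLift ψ (residueIdx ψ x) x i₀ ≠ 0 := (projLift_apply_ne_zero_iff ψ hix).mpr hx
  have hlift : projLift ψ i₀ x = (projLift ψ (residueIdx ψ x) x i₀)⁻¹ • projLift ψ (residueIdx ψ x) x :=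
    projLift_eq_smul_of_mem ψ hix hx
  have hQz : MvPolynomial.eval (projLift ψ i₀ x) Q =
      (projLift ψ (residueIdx ψ x) x i₀)⁻¹ ^ k * MvPolynomial.eval (projLift ψ (residueIdx ψ x) x) Q := by
    rw [hlift, eval_smul_of_isHomogeneous hQ]
  have hXz : MvPolynomial.eval (projLift ψ (residueIdx ψ x) x) (MvPolynomial.X i₀ ^ k) =
      projLift ψ (residueIdx ψ x) x i₀ ^ k := by simp
  change (show E [⋀^Fin m]→L[ℝ] ℂ from (residueFormula ψ F Q (residueIdx ψ x) _ x).restrictScalars ℝ) =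
    MvPolynomial.eval (projLift ψ i₀ x) Q •
      (show E [⋀^Fin m]→L[ℝ] ℂ from
        (residueFormula ψ F (MvPolynomial.X i₀ ^ k) (residueIdx ψ x) _ x).restrictScalars ℝ)
  ext v
  change (residueFormula ψ F Q (residueIdx ψ x) _ x) v = MvPolynomial.eval (projLift ψ i₀ x) Q *
    (residueFormula ψ F (MvPolynomial.X i₀ ^ k) (residueIdx ψ x) _ x) v
  simp only [residueFormula, ContinuousAlternatingMap.smul_apply, smul_eq_mul]
  rw [hXz, hQz]
  have hzk : (projLift ψ (residueIdx ψ x) x i₀)⁻¹ ^ k * projLift ψ (residueIdx ψ x) x i₀ ^ k = 1 := by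
    rw [← mul_pow, inv_mul_cancel₀ hzi₀, one_pow]
  have key : ∀ a cv : ℂ, a * cv = (projLift ψ (residueIdx ψ x) x i₀)⁻¹ ^ k * a *
      (projLift ψ (residueIdx ψ x) x i₀ ^ k * cv) := fun a cv ↦ by
    linear_combination (-(a * cv)) * hzk
  exact key _ _

/-! ### Homogenisation -/

/-- **Homogenisation of a polynomial of degree `≤ k` with respect to the variable `x_{i₀}`**: the form
`Q = Σ_{j ≤ k} q_{(j)}(x_{≠ i₀}) x_{i₀}^{k-j}` is homogeneous of degree `k` and restricts to `q` on `x_{i₀} = 1`.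
[cite: SerreGAGA1956, n° 20] -/
theorem exists_homogenisation {k : ℕ} (q : MvPolynomial (Fin (m + 1)) ℂ) (hq : q.totalDegree ≤ k) (i₀ : Fin (m + 2)) :
    ∃ Q : MvPolynomial (Fin (m + 2)) ℂ, Q.IsHomogeneous k ∧
      ∀ u : Fin (m + 1) → ℂ, MvPolynomial.eval (Fin.insertNth i₀ 1 u) Q = MvPolynomial.eval u q := by
  classical
  refine ⟨∑ j ∈ Finset.range (k + 1), MvPolynomial.rename (Fin.succAbove i₀) (MvPolynomial.homogeneousComponent j q) *
    MvPolynomial.X i₀ ^ (k - j), ?_, fun u ↦ ?_⟩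
  · refine MvPolynomial.IsHomogeneous.sum _ _ _ fun j hj ↦ ?_
    have hjk : j ≤ k := Nat.lt_succ_iff.mp (Finset.mem_range.mp hj)
    have h1 : (MvPolynomial.rename (Fin.succAbove i₀) (MvPolynomial.homogeneousComponent j q)).IsHomogeneous j :=
      (MvPolynomial.homogeneousComponent_isHomogeneous j q).rename_isHomogeneous
    have h2 : (MvPolynomial.X i₀ ^ (k - j) : MvPolynomial (Fin (m + 2)) ℂ).IsHomogeneous (k - j) := by
      simpa using (MvPolynomial.isHomogeneous_X ℂ i₀).pow (k - j)
    have h12 := h1.mul h2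
    rwa [Nat.add_sub_cancel' hjk] at h12
  · rw [map_sum]
    have hcomp : (Fin.insertNth i₀ (1 : ℂ) u) ∘ Fin.succAbove i₀ = u := by
      funext j; simp
    have hterm : ∀ j, MvPolynomial.eval (Fin.insertNth i₀ 1 u)
        (MvPolynomial.rename (Fin.succAbove i₀) (MvPolynomial.homogeneousComponent j q) * MvPolynomial.X i₀ ^ (k - j)) =
        MvPolynomial.eval u (MvPolynomial.homogeneousComponent j q) := by
      intro j
      rw [map_mul, map_pow, MvPolynomial.eval_X, Fin.insertNth_apply_same, one_pow, mul_one, MvPolynomial.eval_rename,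
        hcomp]
    rw [Finset.sum_congr rfl fun j _ ↦ hterm j, ← map_sum]
    congr 1
    -- `q = Σ_{j ≤ k} q_{(j)}`
    conv_rhs => rw [← MvPolynomial.sum_homogeneousComponent q]
    refine (Finset.sum_subset (Finset.range_mono (by omega)) fun j _ hj ↦ ?_).symm
    exact MvPolynomial.homogeneousComponent_eq_zero _ _ (by
      have := Finset.mem_range.not.mp hj; omega)

/-! ### Total degree of a dehomogenisation -/

/-- Substituting polynomials of degree `≤ 1` does not raise the total degree. [folklore] -/
theorem totalDegree_aeval_le_of_forall_le_one {σ τ R : Type*} [CommSemiring R] (φ : σ → MvPolynomial τ R)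
    (hφ : ∀ i, (φ i).totalDegree ≤ 1) (G : MvPolynomial σ R) :
    (MvPolynomial.aeval φ G).totalDegree ≤ G.totalDegree := by
  classical
  rw [G.as_sum, map_sum]
  refine (MvPolynomial.totalDegree_finsetSum _ _).trans (Finset.sup_le fun e he ↦ ?_)
  rw [MvPolynomial.aeval_monomial, MvPolynomial.algebraMap_eq]
  refine (MvPolynomial.totalDegree_mul _ _).trans ?_
  rw [MvPolynomial.totalDegree_C, zero_add, Finsupp.prod]
  refine (MvPolynomial.totalDegree_finsetProd _ _).trans ?_
  refine le_trans (Finset.sum_le_sum fun i _ ↦ (MvPolynomial.totalDegree_pow _ _).trans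
    (Nat.mul_le_mul_left _ (hφ i))) ?_
  simp only [mul_one]
  rw [← G.as_sum]
  exact MvPolynomial.le_totalDegree he


/-- The dehomogenisation `h = F(x_{i₀} = 1)` of a form of degree `d` has total degree `≤ d`. [folklore] -/
theorem totalDegree_dehomogenisation_le (hF : F.IsHomogeneous d) (i₀ : Fin (m + 2)) :
    (MvPolynomial.aeval (Fin.insertNth i₀ (1 : MvPolynomial (Fin (m + 1)) ℂ) MvPolynomial.X) F).totalDegree ≤ d := by
  refine (totalDegree_aeval_le_of_forall_le_one _ (fun l ↦ ?_) F).trans ?_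
  · refine Fin.succAboveCases i₀ ?_ (fun j ↦ ?_) l
    · simp
    · rw [Fin.insertNth_apply_succAbove, MvPolynomial.totalDegree_X]
  · by_cases hF0 : F = 0
    · simp [hF0]
    · rw [hF.totalDegree hF0]

/-- Evaluating the dehomogenisation: `h(u) = F(Z̃)` with `Z̃ = (u with 1 inserted in slot i₀)`. [folklore] -/
theorem eval_dehomogenisation (i₀ : Fin (m + 2)) (u : Fin (m + 1) → ℂ) :
    MvPolynomial.eval u (MvPolynomial.aeval (Fin.insertNth i₀ (1 : MvPolynomial (Fin (m + 1)) ℂ) MvPolynomial.X) F) =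
      MvPolynomial.eval (Fin.insertNth i₀ 1 u) F := by
  rw [MvPolynomial.aeval_def, MvPolynomial.eval₂_comp_left]
  have hcomp : (MvPolynomial.eval u).comp (algebraMap ℂ (MvPolynomial (Fin (m + 1)) ℂ)) = RingHom.id ℂ := by
    ext a; simp
  rw [hcomp]
  unfold MvPolynomial.eval
  rw [MvPolynomial.coe_eval₂Hom]
  congr 1
  funext l
  refine Fin.succAboveCases i₀ ?_ (fun j ↦ ?_) l
  · simp
  · simp only [Function.comp_apply, Fin.insertNth_apply_succAbove, MvPolynomial.eval₂_X]


/-- The sup norm of `Fin.cons t w` is at most the norm of the pair `(w, t)`. [folklore] -/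
theorem norm_cons_le_norm_prod (w : Fin m → ℂ) (t : ℂ) : ‖(Fin.cons t w : Fin (m + 1) → ℂ)‖ ≤ ‖((w, t) : (Fin m → ℂ) × ℂ)‖ := by
  refine (pi_norm_le_iff_of_nonneg (norm_nonneg _)).mpr fun l ↦ ?_
  refine Fin.cases ?_ (fun j ↦ ?_) l
  · rw [Fin.cons_zero, Prod.norm_def]; exact le_max_right _ _
  · rw [Fin.cons_succ, Prod.norm_def]; exact (norm_le_pi_norm w j).trans (le_max_left _ _)

/-! ### Every holomorphic top form is a residue on a chart in normal form -/

/-- **Holomorphic top forms are residues on the chart `M_{i₀}`** (the surjectivity half of `H^{m,0}(X_F) ≅ S^{d-m-2}`,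
Griffiths 1969 §8 ∕ Voisin II Cor. 6.12 at `p = 1`, on one affine chart). Hypotheses: the residue-form setting
(`F` homogeneous of degree `d ≥ m + 2` with non-vanishing gradient on its cone, `M` compact with `dim_ℂ E = m`,
`ψ` a topological embedding onto `V(F)` with holomorphic affine coordinates) and NOETHER NORMAL FORM of the affine
equation `h = F(x_{i₀} = 1)` along `t = u₀`: the coefficient of `t^d` is a non-zero constant `c` and some fibre of the
top-degree family has distinct roots. Then every `m`-form `η` holomorphic in charts equals `ψ^* Res(QΩ/F)` on `M_{i₀}` for
some `Q` homogeneous of degree `d - m - 2`: the ratio `f = η/η_{i₀}` (`η_{i₀} = ψ^* Res(x_{i₀}^{d-m-2}Ω/F)`) read in the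
affine coordinates is a holomorphic function of polynomial growth `d - m - 2` on the smooth affine hypersurface
`{h = 0}`, hence a polynomial of that degree by Serre's algebraisation lemma
(`AffineHypersurface.exists_mvPolynomial_eq_on_hypersurface`), whose homogenisation is `Q`.
[cite: VoisinHodgeII2003, §6.1.3 Cor. 6.12 (p = 1)] [cite: SerreGAGA1956, n° 19–20] -/
theorem exists_eq_residueForm_on_liftDomain [CompactSpace M] [Nonempty M] (hF : F.IsHomogeneous d)
    (hψ : Topology.IsEmbedding ψ) (hrange : Set.range ψ = projZeroLocus {F})
    (hjac : ∀ z : Fin (m + 2) → ℂ, z ≠ 0 → MvPolynomial.eval z F = 0 →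
      ∃ j, MvPolynomial.eval z (MvPolynomial.pderiv j F) ≠ 0)
    (hhol : HasHolomorphicCoords E ψ) (hdim : Module.finrank ℂ E = m) (hd : m + 2 ≤ d)
    (i₀ : Fin (m + 2)) {c : ℂ} (hc : c ≠ 0)
    (hlead : (MvPolynomial.finSuccEquiv ℂ m
      (MvPolynomial.aeval (Fin.insertNth i₀ (1 : MvPolynomial (Fin (m + 1)) ℂ) MvPolynomial.X) F)).coeff d =
        MvPolynomial.C c)
    (hsep : ∃ w₀ : Fin m → ℂ, ((∑ j ∈ Finset.range (d + 1), Polynomial.monomial j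
      (MvPolynomial.homogeneousComponent (d - j) ((MvPolynomial.finSuccEquiv ℂ m
        (MvPolynomial.aeval (Fin.insertNth i₀ (1 : MvPolynomial (Fin (m + 1)) ℂ) MvPolynomial.X) F)).coeff j))).map
          (MvPolynomial.eval w₀)).roots.Nodup)
    {η : MForm 𝓘(ℝ, E) M ℂ m} (hη : IsHolomorphicInCharts η) :
    ∃ Q : MvPolynomial (Fin (m + 2)) ℂ, Q.IsHomogeneous (d - (m + 2)) ∧
      ∀ x ∈ liftDomain ψ i₀, η x = residueForm (E := E) ψ F Q x := by
  classical
  have hψc : Continuous ψ := hψ.continuous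
  set k := d - (m + 2) with hk
  -- the affine equation and its family
  set h : MvPolynomial (Fin (m + 1)) ℂ :=
    MvPolynomial.aeval (Fin.insertNth i₀ (1 : MvPolynomial (Fin (m + 1)) ℂ) MvPolynomial.X) F with hh
  set P : Polynomial (MvPolynomial (Fin m) ℂ) := MvPolynomial.finSuccEquiv ℂ m h with hP
  have hhdeg : h.totalDegree ≤ d := totalDegree_dehomogenisation_le hF i₀
  have hPd : P.natDegree ≤ d := by
    rw [hP, MvPolynomial.natDegree_finSuccEquiv]
    exact (MvPolynomial.degreeOf_le_totalDegree h 0).trans hhdeg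
  have hPcoef : ∀ j, (P.coeff j).totalDegree ≤ d - j := by
    intro j
    by_cases h0 : P.coeff j = 0
    · rw [h0, MvPolynomial.totalDegree_zero]; exact Nat.zero_le _
    · have := MvPolynomial.totalDegree_coeff_finSuccEquiv_add_le h j h0
      rw [← hP] at this
      omega
  have hPeval : ∀ (w : Fin m → ℂ) (t : ℂ), (P.map (MvPolynomial.eval w)).eval t =
      MvPolynomial.eval (Fin.insertNth i₀ 1 (Fin.cons t w)) F := by
    intro w t
    rw [hP, ← MvPolynomial.eval_eq_eval_mv_eval', hh, eval_dehomogenisation]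
  -- the frame `ρ = Res(x_{i₀}^k Ω/F)` and the ratio `f = η/ρ`
  set ρ : MForm 𝓘(ℝ, E) M ℂ m := residueForm (E := E) ψ F (MvPolynomial.X i₀ ^ k) with hρ
  have hXk : (MvPolynomial.X i₀ ^ k : MvPolynomial (Fin (m + 2)) ℂ).IsHomogeneous (d - (m + 2)) := by
    simpa using (MvPolynomial.isHomogeneous_X ℂ i₀).pow k
  have hρhol : IsHolomorphicInCharts ρ := isHolomorphicInCharts_residueForm ψ hF hψc hrange.le hjac hhol hXk hd
  have hρne : ∀ x ∈ liftDomain ψ i₀, ρ x ≠ 0 := fun x hx ↦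
    residueForm_ne_zero ψ hF hψ hrange.le hjac hhol hdim hd hx
  set b : Module.Basis (Fin m) ℂ E := Module.finBasisOfFinrankEq ℂ E hdim with hb
  have hρb : ∀ x ∈ liftDomain ψ i₀, (ρ x : E [⋀^Fin m]→L[ℝ] ℂ) b ≠ 0 := fun x hx ↦
    hρhol.apply_basis_ne_zero b (hρne x hx)
  set f : M → ℂ := fun x ↦ (η x : E [⋀^Fin m]→L[ℝ] ℂ) b / (ρ x : E [⋀^Fin m]→L[ℝ] ℂ) b with hf
  have hηf : ∀ x ∈ liftDomain ψ i₀, η x = f x • ρ x := by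
    intro x hx
    obtain ⟨a, ha⟩ := hρhol.exists_apply_eq_restrictScalars x
    exact topForm_eq_ratio_smul hη.isOfType b ha (hρb x hx)
  have hfdiff : ∀ x ∈ liftDomain ψ i₀, MDifferentiableAt 𝓘(ℂ, E) 𝓘(ℂ, ℂ) f x := by
    intro x hx
    have hne : ∀ᶠ y in 𝓝 x, (ρ y : E [⋀^Fin m]→L[ℝ] ℂ) b ≠ 0 := by
      filter_upwards [(isOpen_liftDomain ψ hψc i₀).mem_nhds hx] with y hy using hρb y hy
    exact mdifferentiableAt_topFormRatio_of_isHolomorphicInCharts hdim hη hρhol b.linearIndependent hne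
  -- growth of `f` in the affine coordinates
  obtain ⟨C₀, hC₀⟩ := exists_bound_topFormRatio ψ hF hψ hrange.le hjac hhol hdim hd hη b i₀
  set C := max C₀ 0 with hCdef
  have hC : 0 ≤ C := le_max_right _ _
  have hgrowth : ∀ x ∈ liftDomain ψ i₀, ‖f x‖ ≤ C * (1 + ‖affineCoord ψ i₀ x‖) ^ k := fun x hx ↦
    (hC₀ x hx).trans (mul_le_mul_of_nonneg_right (le_max_left _ _) (by positivity))
  -- `f` transported to the affine coordinates `u = Fin.cons t w`
  set g₁ : (Fin (m + 1) → ℂ) → ℂ := fun u ↦ f (Function.invFunOn (affineCoord ψ i₀) (liftDomain ψ i₀) u) with hg₁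
  have hinj := injOn_affineCoord ψ hψ.injective i₀
  have hg₁f : ∀ x ∈ liftDomain ψ i₀, g₁ (affineCoord ψ i₀ x) = f x := fun x hx ↦ by
    simp only [hg₁, hinj.leftInvOn_invFunOn hx]
  have himage : affineCoord ψ i₀ '' liftDomain ψ i₀ = {u | MvPolynomial.eval (Fin.insertNth i₀ (1 : ℂ) u) F = 0} :=
    affineCoord_image_liftDomain ψ hF hrange i₀
  set g : (Fin m → ℂ) × ℂ → ℂ := fun p ↦ g₁ (Fin.cons p.2 p.1) with hg
  have hmemU : ∀ p : (Fin m → ℂ) × ℂ, (P.map (MvPolynomial.eval p.1)).eval p.2 = 0 →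
      (Fin.cons p.2 p.1 : Fin (m + 1) → ℂ) ∈ affineCoord ψ i₀ '' liftDomain ψ i₀ := by
    intro p hp
    rw [himage, Set.mem_setOf_eq, ← hPeval]; exact hp
  have hghol : ∀ p : (Fin m → ℂ) × ℂ, (P.map (MvPolynomial.eval p.1)).eval p.2 = 0 →
      ∃ W : Set ((Fin m → ℂ) × ℂ), IsOpen W ∧ p ∈ W ∧ ∃ G : (Fin m → ℂ) × ℂ → ℂ, DifferentiableOn ℂ G W ∧
        ∀ y ∈ W, (P.map (MvPolynomial.eval y.1)).eval y.2 = 0 → G y = g y := by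
    intro p hp
    set e : (Fin m → ℂ) × ℂ → (Fin (m + 1) → ℂ) := fun q ↦ Fin.cons q.2 q.1 with he
    have hediff : Differentiable ℂ e := by
      refine differentiable_pi.mpr fun l ↦ ?_
      refine Fin.cases ?_ (fun j ↦ ?_) l
      · simp only [he, Fin.cons_zero]; exact differentiable_snd
      · simp only [he, Fin.cons_succ]; exact (differentiable_pi.mp differentiable_fst) j
    obtain ⟨W, hWo, hpW, G, hG, hGg⟩ := exists_differentiableOn_eqOn_image_affineCoord ψ hF hψ hrange.le hjac hhol hdim
      hfdiff hg₁f (hmemU p hp)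
    refine ⟨e ⁻¹' W, hWo.preimage hediff.continuous, hpW, G ∘ e, hG.comp hediff.differentiableOn fun q hq ↦ hq,
      fun y hyW hy ↦ ?_⟩
    simp only [Function.comp_apply, hg]
    exact hGg (e y) hyW (hmemU y hy)
  have hggr : ∀ p : (Fin m → ℂ) × ℂ, (P.map (MvPolynomial.eval p.1)).eval p.2 = 0 → ‖g p‖ ≤ C * (1 + ‖p‖) ^ k := by
    intro p hp
    obtain ⟨x, hx, hxu⟩ := hmemU p hp
    have h1 : g p = f x := by simp only [hg, ← hxu, hg₁f x hx]
    rw [h1]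
    refine (hgrowth x hx).trans (mul_le_mul_of_nonneg_left (pow_le_pow_left₀ (by positivity) ?_ _) hC)
    rw [hxu]
    linarith [norm_cons_le_norm_prod p.1 p.2]
  -- Serre's algebraisation lemma
  obtain ⟨q, hqdeg, hqg⟩ := exists_mvPolynomial_eq_on_hypersurface' P hc hPd hlead hPcoef hsep hghol hC hggr
  -- homogenise
  obtain ⟨Q, hQ, hQq⟩ := exists_homogenisation q hqdeg i₀
  refine ⟨Q, hQ, fun x hx ↦ ?_⟩
  have hu : MvPolynomial.eval (projLift ψ i₀ x) Q = f x := by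
    have hucons : (Fin.cons (affineCoord ψ i₀ x 0) (Fin.tail (affineCoord ψ i₀ x)) : Fin (m + 1) → ℂ) =
        affineCoord ψ i₀ x := Fin.cons_self_tail _
    have hU : (P.map (MvPolynomial.eval (Fin.tail (affineCoord ψ i₀ x)))).eval (affineCoord ψ i₀ x 0) = 0 := by
      rw [hPeval, hucons]
      exact eval_projLift_eq_zero ψ hF hrange.le hx
    have h1 := hqg (Fin.tail (affineCoord ψ i₀ x)) (affineCoord ψ i₀ x 0) hU
    rw [hucons] at h1
    rw [projLift, hQq, h1]
    simp only [hg, hucons, hg₁f x hx]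
  rw [hηf x hx, residueForm_eq_eval_smul ψ hQ hx, hu]

end Summit.HodgeConjecture.HodgeConjecture.Theorems.SmoothHypersurfaceTopFormsOnChart

end
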